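import Summits.AtomisticToContinuum.Crystallization.Theorems.ShellsToBarlowChart.Negative.Calibration

/-!
# Line `develop-the-model-growth-descent` (crux `ShellsToBarlowChart`, stmt-AtomisticToContinuum-9227): vocabulary

Definitions (D-0016: reviewed, proofs live in the sibling files
`PalmUnimodularRigidityShellsToBarlowChart<Stub>.lean`) of the line that develops the ideal Barlow
stacking `B = barlowStacking 1 √(2/3) s` into an every-point-good set `S` by a bond covering
`Ψ : B → S` and then descends by growth (cubic growth of `S` against quadratic growth of a proper
quotient of `B`).  The crux hypothesis / conclusion are NOT restated: they are the landed
parametrisation `GoodShellAt (9/10) 1` / `BarlowChart` of `Negative/Calibration.lean`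
(`shellsToBarlowChart_iff_scaled : ShellsToBarlowChart ↔ … := Iff.rfl`).

* `GoodShells S` — every point of `S` has a `1 %`-good FCC/HCP shell (the crux hypothesis on `S`);
* `IsBond x y` — the bond (window) relation `0 < dist x y ≤ 28/25` of the crux conclusion;
* `bondNbrs S x` — the bonded neighbours of `x` in `S`;
* `contacts s p` — the twelve touching sites of `p` in the model `B`;
* `windowGraph S`, `windowBall S x n` — the bond graph of `S` and its closed graph balls;
* `LocalChart S x` — the exact local chart at `x` (labels by the FCC or HCP pattern, bonds among
  neighbours = pattern contacts);
* `IsBondCovering S s Ψ` — `Ψ : B → S` onto, star-bijective and link-faithful;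
* `IsContactAut s σ` — a bijection of `B` preserving and reflecting contacts.

All `[folklore]` (standard notions of graph coverings / contact graphs, specialised to this crux).
-/

noncomputable section

namespace Summit.AtomisticToContinuum.Crystallization.Theorems.PalmUnimodularRigidityShellsToBarlowChart

open Literature.Geometry.DiscreteGeometry Literature.MathematicalPhysics.StatisticalMechanics
open Summit.AtomisticToContinuum.Crystallization.Theorems.ShellsToBarlowChartNegative

/-- Euclidean `3`-space. -/
local notation "E3" => EuclideanSpace ℝ (Fin 3)

/-- Every point of `S` has a `1 %`-good FCC/HCP shell at its own scale in `[9/10, 1]`: the crux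
hypothesis on `S`, through the landed parametrisation `GoodShellAt`. [folklore] -/
def GoodShells (S : Set E3) : Prop := ∀ x ∈ S, GoodShellAt (9 / 10) 1 S x

/-- The bond relation of the crux conclusion: distance in the window `(0, 28/25]`. [folklore] -/
def IsBond (x y : E3) : Prop := 0 < dist x y ∧ dist x y ≤ 28 / 25

/-- The bonded neighbours of `x` inside `S`. [folklore] -/
def bondNbrs (S : Set E3) (x : E3) : Set E3 := {y | y ∈ S ∧ IsBond x y}

/-- The twelve contacts of `p` in the MODEL `B := barlowStacking 1 √(2/3) s` (ideal stacking with
unit touching distance). [folklore] -/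
def contacts (s : ℤ → ℤ) (p : E3) : Set E3 :=
  {q | q ∈ barlowStacking 1 (Real.sqrt (2 / 3)) s ∧ dist p q = 1}

/-- The window (bond) graph of `S`: vertices of `S`, edges = bonds. [folklore] -/
def windowGraph (S : Set E3) : SimpleGraph E3 :=
  SimpleGraph.fromRel fun x y => x ∈ S ∧ y ∈ S ∧ IsBond x y

/-- The closed ball of radius `n` about `x` in the window graph of `S` (endpoints of walks of
length `≤ n`). [folklore] -/
def windowBall (S : Set E3) (x : E3) (n : ℕ) : Set E3 :=
  {y | ∃ w : (windowGraph S).Walk x y, w.length ≤ n}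

/-- LOCAL CHART at `x`: the bonded neighbours of `x` are an `a/100`-perturbed rotated copy of the
`a`-scaled FCC or HCP kissing pattern (`a ∈ [9/10, 1]`, `A` a linear isometry, `e` the labelling
bijection from the unit pattern onto the neighbours), and two neighbours are bonded iff their
labels touch in the pattern ("window graph = shell graph, links exact"). [folklore] -/
def LocalChart (S : Set E3) (x : E3) : Prop :=
  ∃ a : ℝ, 9 / 10 ≤ a ∧ a ≤ 1 ∧ ∃ P : Finset E3, (P = fccKissingPattern ∨ P = hcpKissingPattern) ∧
    ∃ A : E3 →ₗᵢ[ℝ] E3, ∃ e : E3 → E3, Set.BijOn e (↑P : Set E3) (bondNbrs S x) ∧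
      (∀ v ∈ P, dist (e v) (x + a • A v) ≤ a / 100) ∧
      (∀ v ∈ P, ∀ w ∈ P, (dist v w = 1 ↔ IsBond (e v) (e w)))

/-- BOND COVERING of `S` by the model with Hägg word `s`: `Ψ` maps `B` into and onto `S`, the
contacts of every site bijectively onto the bonded neighbours of its image (star-bijective), and
is faithful on links (two contacts of a site touch iff their images are bonded).  Strictly weaker
than the crux conclusion (it holds for every quotient `B/Γ`); injectivity is NOT asked. [folklore] -/
def IsBondCovering (S : Set E3) (s : ℤ → ℤ) (Ψ : E3 → E3) : Prop :=
  Set.MapsTo Ψ (barlowStacking 1 (Real.sqrt (2 / 3)) s) S ∧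
    Set.SurjOn Ψ (barlowStacking 1 (Real.sqrt (2 / 3)) s) S ∧
    (∀ p ∈ barlowStacking 1 (Real.sqrt (2 / 3)) s, Set.BijOn Ψ (contacts s p) (bondNbrs S (Ψ p))) ∧
    (∀ p ∈ barlowStacking 1 (Real.sqrt (2 / 3)) s, ∀ q ∈ contacts s p, ∀ q' ∈ contacts s p,
      (dist q q' = 1 ↔ IsBond (Ψ q) (Ψ q')))

/-- CONTACT AUTOMORPHISM of the model: a bijection of `B` onto itself preserving and reflecting
contacts. [folklore] -/
def IsContactAut (s : ℤ → ℤ) (σ : E3 → E3) : Prop :=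
  Set.BijOn σ (barlowStacking 1 (Real.sqrt (2 / 3)) s) (barlowStacking 1 (Real.sqrt (2 / 3)) s) ∧
    ∀ q ∈ barlowStacking 1 (Real.sqrt (2 / 3)) s, ∀ q' ∈ barlowStacking 1 (Real.sqrt (2 / 3)) s,
      (dist (σ q) (σ q') = 1 ↔ dist q q' = 1)


/-- Anchor (registered sub-goal of stmt-AtomisticToContinuum-9227): the bond relation is
symmetric. [folklore] -/
theorem isBond_symm : ∀ x y : EuclideanSpace ℝ (Fin 3), IsBond x y → IsBond y x := by
  intro x y h
  unfold IsBond at h ⊢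
  rw [dist_comm]
  exact h

end Summit.AtomisticToContinuum.Crystallization.Theorems.PalmUnimodularRigidityShellsToBarlowChart

end
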